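import Literature.MathematicalPhysics.QuantumFieldTheory.Federbush1986.ModeAnalyticityThms31to33Corrected

/-!
# Federbush–Williamson, *A phase cell approach to Yang–Mills theory. II. Analysis of a mode* (J. Math. Phys. **28**
# (1987) 1416–1419) [FederbushWilliamson1987PhaseCellII] — THEOREM 3.3 (boundedness, (3.5)) PROVED for the mode in the
# corrected gauge `X_c = X/(1+g)`; THEOREMS 3.1–3.3 packaged; and §IV: I (3.13)–(3.15) for the corrected mode
# [Federbush1986PhaseCellI p. 328] via `ModeDecay.decay313to315_modeField`

statement-level skeleton of published theorems with citation tags; proofs where landed; nothing here is a claim about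
the Yang–Mills mass gap

Cell `lit-balaban`, Phase-2 proof seat **p04** (gen 9), own lane F2 (rows `F2.Thm3.3`, `F2.Thm3.1`, `F2.Thm3.2`,
`F1.Eq3.13-3.15`; owner r17, referee ref-5); file 5 (last) of the corrected-gauge programme.  Pages READ AS IMAGES:
`run/shared/lean/pub/pub-balaban/t4/b2b-balaban-t4-lit2/g7/fw1987II/fedwill1987-jmp28-II-p002-x2.png` (II p. 1417: «Theorem 3.3
(Boundedness): Within the domain, 𝒟_B, specified by |Im p_j| < ε₀/2, (3.4) A^N_i(p) satisfies bounds of the form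
|A^N_i(p)| < c∏_j (1/(|p_j| + 1)) (1/(|p²| + 1)). (3.5) … IV. CONCLUSIONS Equations (3.13)–(3.15) of Ref. 1 follow directly
from Theorems 3.2 and 3.3 of the last section by standard techniques.») and `HOME/lit-balaban-r17/renders/fedI/
fed1986-cmp107-p010-x2.png` (I p. 328, (3.13)–(3.15)).

HOW (3.5) IS PROVED for `Â = A′ + pX_c` (its global holomorphic representative `gcorr s i` of file 4).  A point `p` of
`𝒟_B(δ₀)` is `q + 2πm` with `m = cellIdx p` and `q` in the COMPACT closed half-tube `K = {|Re q_j| ≤ π, |Im q_j| ≤ δ₀/2}`.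
On the home cell `m = 0`, `gcorr = G0` is bounded on `K` (continuity) and the majorant of (3.5) is bounded below there.
On a translated cell `m ≠ 0`, `gcorr = Gm s m i` (file 2) is `Φ(p)λ₁λ_i·A_i(q)/p² + Φ(p)λ₁p_ir₀(p)³∏λ_j²·B(q)/((p²)⁴(1+p²)^s)`
with `A_i`, `B` continuous on the tube, hence bounded on `K` (compactness), and the explicit factors carry the decay:
`|φ_∓(z)| ≤ 8/(1 + |z|)` for `|Im z| ≤ 1` gives `|Φ(p)| ≤ 40∏_{j≠1}(1 + |p_j|)⁻¹` and `|r₀(p)| ≤ 8⁸`; `|λ₁|(1 + |p₁|) ≤ 6`,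
`|λ_j| ≤ 2`; and on the translated cells `|p²| ≥ 5`, `|1 + p²| ≥ 6`, `|p_i| ≤ |p²| + 1`.  Hence `|gcorr| ≤ c·∏_j(1+|p_j|)⁻¹·
(1+|p²|)⁻¹` on `𝒟_B(δ₀)` with an (inexplicit, compactness) constant `c = c(s, i)` — print's «bounds of the form», constant
unspecified there as well.

WHAT IS PROVED (kernel-checked; axioms standard; object `def`s `Acoef`, `Bcoef`, `Kc` only; no `Prop` definitions, no
named facts):
* §1–§3 the elementary bounds above; §4 the compact half-tube `Kc` and the compactness constants; §5 **`norm_gcorr_le`**: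
  `∃ c, ∀ p ∈ DB δ₀, ‖gcorr s i p‖ ≤ c·∏_j(‖p_j‖+1)⁻¹·(‖p²‖+1)⁻¹` — Theorem 3.3's bound for `Â_i`;
* §6 **`theorem33_corrected`** (the shape of `ModeAnalyticity.Theorem33` with `A^N ↦ Â`, `ε₀ = δ₀`), and
  **`theorems31to33_corrected`** — EXACTLY the body of `ModeAnalyticity.Theorems31to33` (refuted for the printed `A^N`,
  p250244) with `AN` replaced by `ANc` (and `s₀ = 0`: every `s` works);
* §7 **§IV / I (3.13)–(3.15) for the corrected mode**: `decay313to315_corrected s : ∃ g, (∀ i, ∀ p ∈ realGeneric, g i p =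
  ANc s i p) ∧ AbelianAveraging.Decay313to315 (ModeDecay.modeField g)` — r17's Paley–Wiener theorem
  `ModeDecay.decay313to315_of_theorem33_shape` (p265092) BY NAME applied to the four components.
Honest scope: `X_c` is OUR correction of the gauge choice (2.5) (print's `A^N` stays refuted as typed); the decay constants
`c`, `γ = δ₀/4` are inexplicit (compactness), as in print.
-/

noncomputable section

namespace Literature.MathematicalPhysics.QuantumFieldTheory.Federbush1986

namespace ModeAnalyticityThm33Corrected

open ModeAnalyticity ModeAnalyticityLatticeSums ModeAnalyticityBracketSplit ModeAnalyticityGaugeRepair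
  ModeAnalyticityWideTube ModeAnalyticityCorrectedGauge ModeAnalyticityCellPositivity ModeAnalyticityThms31to33Corrected
  ModeDecay Complex Filter Topology Finset Metric Set
open scoped BigOperators Real

/-! ## §1. Decay of the entire factors `φ_∓`, `Φ`, `r₀` on a strip -/

/-- `|φ₋(z)| = |(e^{−iz} − 1)/z| ≤ 8/(1 + |z|)` for `|Im z| ≤ 1`. [cite: FederbushWilliamson1987PhaseCellII, (1.7) p. 1416,
(3.5) p. 1417] -/
theorem norm_phiM_le {z : ℂ} (hz : |z.im| ≤ 1) : ‖phiM z‖ ≤ 8 / (1 + ‖z‖) := by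
  have h0 : 0 ≤ ‖z‖ := norm_nonneg z
  rw [le_div_iff₀ (by positivity)]
  rcases le_or_gt ‖z‖ 1 with h1 | h1
  · -- small `z`: `|e^{−iz} − 1| ≤ 2|z|`
    have hb : ‖phiM z‖ ≤ 2 := by
      by_cases hz0 : z = 0
      · rw [hz0, phiM_zero]; simp
      · rw [phiM_of_ne hz0, norm_div, div_le_iff₀ (norm_pos_iff.mpr hz0)]
        have h := Complex.norm_exp_sub_one_le (x := -I * z) (by simpa using h1)
        simpa using h
    nlinarith [norm_nonneg (phiM z)]
  · -- large `z`: `|e^{−iz}| = e^{Im z} ≤ e`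
    have hz0 : z ≠ 0 := by intro h; rw [h, norm_zero] at h1; linarith
    have hexp : ‖exp (-I * z)‖ ≤ 3 := by
      rw [Complex.norm_exp]
      have hre : (-I * z).re = z.im := by simp
      rw [hre]
      calc Real.exp z.im ≤ Real.exp 1 := Real.exp_le_exp.mpr (le_of_abs_le hz)
        _ ≤ 3 := by have := Real.exp_one_lt_d9; linarith
    have h4 : ‖exp (-I * z) - 1‖ ≤ 4 :=
      calc ‖exp (-I * z) - 1‖ ≤ ‖exp (-I * z)‖ + ‖(1 : ℂ)‖ := norm_sub_le _ _
        _ ≤ 4 := by rw [norm_one]; linarith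
    rw [phiM_of_ne hz0, norm_div]
    rw [div_mul_eq_mul_div, div_le_iff₀ (by linarith)]
    nlinarith [norm_nonneg (exp (-I * z) - 1)]

/-- `|φ₊(z)| = |(e^{iz} − 1)/z| ≤ 8/(1 + |z|)` for `|Im z| ≤ 1`. [cite: FederbushWilliamson1987PhaseCellII, (5.4) p. 1418,
(3.5) p. 1417] -/
theorem norm_phiP_le {z : ℂ} (hz : |z.im| ≤ 1) : ‖phiP z‖ ≤ 8 / (1 + ‖z‖) := by
  have h0 : 0 ≤ ‖z‖ := norm_nonneg z
  rw [le_div_iff₀ (by positivity)]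
  rcases le_or_gt ‖z‖ 1 with h1 | h1
  · have hb : ‖phiP z‖ ≤ 2 := by
      by_cases hz0 : z = 0
      · rw [hz0, phiP_zero]; simp
      · rw [phiP_of_ne hz0, norm_div, div_le_iff₀ (norm_pos_iff.mpr hz0)]
        have h := Complex.norm_exp_sub_one_le (x := I * z) (by simpa using h1)
        simpa using h
    nlinarith [norm_nonneg (phiP z)]
  · have hz0 : z ≠ 0 := by intro h; rw [h, norm_zero] at h1; linarith
    have hexp : ‖exp (I * z)‖ ≤ 3 := by
      rw [Complex.norm_exp]
      have hre : (I * z).re = -z.im := by simp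
      rw [hre]
      calc Real.exp (-z.im) ≤ Real.exp 1 := Real.exp_le_exp.mpr (by linarith [neg_abs_le z.im])
        _ ≤ 3 := by have := Real.exp_one_lt_d9; linarith
    have h4 : ‖exp (I * z) - 1‖ ≤ 4 :=
      calc ‖exp (I * z) - 1‖ ≤ ‖exp (I * z)‖ + ‖(1 : ℂ)‖ := norm_sub_le _ _
        _ ≤ 4 := by rw [norm_one]; linarith
    rw [phiP_of_ne hz0, norm_div]
    rw [div_mul_eq_mul_div, div_le_iff₀ (by linarith)]
    nlinarith [norm_nonneg (exp (I * z) - 1)]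

/-- (plumbing) both factors are bounded by `8` on the strip. [cite: FederbushWilliamson1987PhaseCellII, (5.4) p. 1418] -/
theorem norm_phiM_le_eight {z : ℂ} (hz : |z.im| ≤ 1) : ‖phiM z‖ ≤ 8 ∧ ‖phiP z‖ ≤ 8 := by
  have h0 : (1 : ℝ) ≤ 1 + ‖z‖ := by have := norm_nonneg z; linarith
  constructor
  · exact (norm_phiM_le hz).trans (div_le_self (by norm_num) h0)
  · exact (norm_phiP_le hz).trans (div_le_self (by norm_num) h0)

/-- **`|Φ(p)| ≤ 40·∏_{j≠1}(1 + |p_j|)⁻¹`** on the strip `|Im p_j| ≤ 1` — the `∏_j 1/(|p_j|+1)` decay of (3.5) in the directions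
`j ≠ 1` comes from the prefactor `r_L` (1.7). [cite: FederbushWilliamson1987PhaseCellII, (1.7) p. 1416, (3.5), (5.1) p. 1417] -/
theorem norm_Phi_le {p : Momentum} (hp : ∀ j, |(p j).im| ≤ 1) :
    ‖Phi p‖ ≤ 40 * ((‖p 1‖ + 1)⁻¹ * (‖p 2‖ + 1)⁻¹ * (‖p 3‖ + 1)⁻¹) := by
  have hc : ‖I / (2 * (π : ℂ)) ^ 2‖ ≤ 1 / 39 := by
    rw [norm_div, norm_pow, Complex.norm_I]
    have : ‖(2 : ℂ) * π‖ = 2 * π := by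
      rw [norm_mul, Complex.norm_ofNat, Complex.norm_real, Real.norm_of_nonneg Real.pi_pos.le]
    rw [this]
    rw [div_le_div_iff₀ (by positivity) (by norm_num)]
    nlinarith [Real.pi_gt_d2]
  have he : ‖-exp (-I * p 0)‖ ≤ 3 := by
    rw [norm_neg, Complex.norm_exp]
    have hre : (-I * p 0).re = (p 0).im := by simp
    rw [hre]
    calc Real.exp (p 0).im ≤ Real.exp 1 := Real.exp_le_exp.mpr (le_of_abs_le (hp 0))
      _ ≤ 3 := by have := Real.exp_one_lt_d9; linarith
  have h1 := norm_phiM_le (hp 1); have h2 := norm_phiM_le (hp 2); have h3 := norm_phiM_le (hp 3)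
  have e : ∀ j, 8 / (1 + ‖p j‖) = 8 * (‖p j‖ + 1)⁻¹ := fun j => by rw [div_eq_mul_inv, add_comm]
  rw [e] at h1 h2 h3
  unfold Phi
  rw [norm_mul, norm_mul, norm_mul, norm_mul]
  calc ‖I / (2 * (π : ℂ)) ^ 2‖ * ‖-exp (-I * p 0)‖ * (‖phiM (p 1)‖ * ‖phiM (p 2)‖ * ‖phiM (p 3)‖)
      ≤ (1 / 39) * 3 * ((8 * (‖p 1‖ + 1)⁻¹) * (8 * (‖p 2‖ + 1)⁻¹) * (8 * (‖p 3‖ + 1)⁻¹)) := by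
        gcongr
    _ ≤ 40 * ((‖p 1‖ + 1)⁻¹ * (‖p 2‖ + 1)⁻¹ * (‖p 3‖ + 1)⁻¹) := by
        have : 0 ≤ (‖p 1‖ + 1)⁻¹ * (‖p 2‖ + 1)⁻¹ * (‖p 3‖ + 1)⁻¹ := by positivity
        nlinarith

/-- **`|r₀(p)| ≤ 8⁸`** on the strip `|Im p_j| ≤ 1`. [cite: FederbushWilliamson1987PhaseCellII, (5.4) p. 1418] -/
theorem norm_r0_le {p : Momentum} (hp : ∀ j, |(p j).im| ≤ 1) : ‖r0 p‖ ≤ 8 ^ 8 := by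
  unfold r0
  rw [norm_prod]
  calc ∏ j, ‖phiM (p j) * phiP (p j)‖ ≤ ∏ _j : Fin 4, (64 : ℝ) := by
        refine Finset.prod_le_prod (fun j _ => norm_nonneg _) fun j _ => ?_
        rw [norm_mul]
        have := norm_phiM_le_eight (hp j)
        nlinarith [norm_nonneg (phiM (p j)), norm_nonneg (phiP (p j))]
    _ = 8 ^ 8 := by norm_num

/-! ## §2. The factors `λ_j` on the cells -/

/-- (plumbing) coordinates of `q = p − 2πm` are small on the tube: `‖q_j‖ < 4`. [cite: FederbushWilliamson1987PhaseCellII,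
(3.1)–(3.2) p. 1417] -/
theorem norm_unshift_lt {m : Idx} {p : Momentum} (hp : p ∈ cellSet m delta0) (j : Fin 4) : ‖unshift m p j‖ < 4 := by
  have h := Complex.norm_le_abs_re_add_abs_im (unshift m p j)
  have h1 := (hp j).1; have h2 := (hp j).2
  have := delta0_le
  nlinarith [Real.pi_lt_d2]

/-- **`|λ_j| ≤ 2`** on the translated cells. [cite: FederbushWilliamson1987PhaseCellII, (3.1) p. 1417] -/
theorem norm_lam_le {m : Idx} {p : Momentum} (hp : p ∈ cellSet m delta0) (j : Fin 4) : ‖lam m j p‖ ≤ 2 := by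
  have hδ : delta0 ≤ 1 / 2 := delta0_le.trans (by norm_num)
  by_cases hmj : m j = 0
  · rw [lam_of_eq_zero hmj]; simp
  · have hpj := apply_ne_zero_of_mem_cellSet hmj hδ hp
    rw [lam_eq_div hpj, norm_div, div_le_iff₀ (norm_pos_iff.mpr hpj)]
    have h1 := norm_unshift_lt hp j
    have h2 : 5 / 2 ≤ ‖p j‖ := by
      have h := abs_re_ge_of_mem_cellSet hmj hδ hp
      have h1 : (1 : ℝ) ≤ |(m j : ℝ)| := by rw [← Int.cast_abs]; exact_mod_cast Int.one_le_abs hmj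
      have := Complex.abs_re_le_norm (p j)
      nlinarith
    nlinarith

/-- **`|λ₁|·(1 + |p₁|) ≤ 6`** on the translated cells: `λ₁` carries the decay of (3.5) in the special direction (either
`m₁ = 0` and `p₁` is bounded, or `λ₁ = q₁/p₁`). [cite: FederbushWilliamson1987PhaseCellII, (3.1), (3.5) p. 1417] -/
theorem norm_lam_zero_le {m : Idx} {p : Momentum} (hp : p ∈ cellSet m delta0) :
    ‖lam m 0 p‖ ≤ 6 * (‖p 0‖ + 1)⁻¹ := by
  have hδ : delta0 ≤ 1 / 2 := delta0_le.trans (by norm_num)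
  rw [← div_eq_mul_inv, le_div_iff₀ (by positivity)]
  by_cases hm0 : m 0 = 0
  · rw [lam_of_eq_zero hm0, norm_one, one_mul]
    have h1 := norm_unshift_lt hp 0
    have : unshift m p 0 = p 0 := by simp [unshift, hm0]
    rw [this] at h1
    linarith
  · have hp0 := apply_ne_zero_of_mem_cellSet hm0 hδ hp
    have hpos := norm_pos_iff.mpr hp0
    rw [lam_eq_div hp0, norm_div]
    have h1 := norm_unshift_lt hp 0
    have h2 : 5 / 2 ≤ ‖p 0‖ := by
      have h := abs_re_ge_of_mem_cellSet hm0 hδ hp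
      have h1 : (1 : ℝ) ≤ |(m 0 : ℝ)| := by rw [← Int.cast_abs]; exact_mod_cast Int.one_le_abs hm0
      have := Complex.abs_re_le_norm (p 0)
      nlinarith
    rw [div_mul_eq_mul_div, div_le_iff₀ hpos]
    nlinarith [norm_nonneg (unshift m p 0)]

/-- (plumbing) `|∏_jλ_j²| ≤ 256`. [cite: FederbushWilliamson1987PhaseCellII, (3.1) p. 1417] -/
theorem norm_prod_lam_sq_le {m : Idx} {p : Momentum} (hp : p ∈ cellSet m delta0) : ‖∏ j, lam m j p ^ 2‖ ≤ 256 := by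
  rw [norm_prod]
  calc ∏ j, ‖lam m j p ^ 2‖ ≤ ∏ _j : Fin 4, (4 : ℝ) := by
        refine Finset.prod_le_prod (fun j _ => norm_nonneg _) fun j _ => ?_
        rw [norm_pow]
        have := norm_lam_le hp j
        nlinarith [norm_nonneg (lam m j p)]
    _ = 256 := by norm_num

/-! ## §3. `p²` on the translated cells -/

/-- On a translated cell `m ≠ 0`: `|p_i| ≤ |p²| + 1` (the large real part of `p` dominates).
[cite: FederbushWilliamson1987PhaseCellII, (3.1), (3.5) p. 1417] -/
theorem norm_apply_le_norm_csq {m : Idx} (hm : m ≠ 0) {p : Momentum} (hp : p ∈ cellSet m delta0) (i : Fin 4) :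
    ‖p i‖ ≤ ‖csq p‖ + 1 := by
  have hδ : delta0 ≤ 1 / 2 := delta0_le.trans (by norm_num)
  have h5 := norm_csq_ge_of_mem_cellSet hm hδ hp
  have him : ∀ l, |(p l).im| < 1 / 4 := fun l => by
    have h := (hp l).2; rw [unshift_im] at h; exact h.trans_le delta0_le
  have hni : ‖p i‖ ≤ |(p i).re| + 1 / 4 := by
    have := Complex.norm_le_abs_re_add_abs_im (p i); have := him i; linarith
  rcases le_or_gt |(p i).re| 1 with h1 | h1
  · linarith
  · -- `Re p² ≥ (Re p_i)² − Σ(Im)² ≥ |Re p_i| − 1/4`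
    have hre : (csq p).re ≥ |(p i).re| - 1 / 4 := by
      unfold csq
      rw [Complex.re_sum]
      have e : ∀ l, ((p l) ^ 2).re = (p l).re ^ 2 - (p l).im ^ 2 := fun l => by rw [pow_two, Complex.mul_re]; ring
      simp_rw [e]
      rw [Finset.sum_sub_distrib]
      have hA : (p i).re ^ 2 ≤ ∑ l, (p l).re ^ 2 :=
        Finset.single_le_sum (f := fun l => (p l).re ^ 2) (fun l _ => sq_nonneg _) (Finset.mem_univ i)
      have hB : ∑ l : Fin 4, (p l).im ^ 2 ≤ ∑ _l : Fin 4, (1 / 16 : ℝ) := Finset.sum_le_sum fun l _ => by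
        have := him l; nlinarith [abs_nonneg ((p l).im), sq_abs ((p l).im)]
      simp only [Finset.sum_const, Finset.card_univ, Fintype.card_fin, nsmul_eq_mul] at hB
      have hsq : |(p i).re| ≤ (p i).re ^ 2 := by
        rw [← sq_abs]; nlinarith
      norm_num at hB
      linarith
    have := Complex.re_le_norm (csq p)
    linarith

/-- (plumbing) `|p²|⁻¹ ≤ (6/5)(|p²| + 1)⁻¹` when `|p²| ≥ 5`. [cite: FederbushWilliamson1987PhaseCellII, (3.5) p. 1417] -/
theorem inv_norm_csq_le {p : Momentum} (h5 : 5 ≤ ‖csq p‖) : ‖csq p‖⁻¹ ≤ 6 / 5 * (‖csq p‖ + 1)⁻¹ := by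
  rw [← div_eq_mul_inv, inv_eq_one_div, div_le_div_iff₀ (by linarith) (by linarith)]
  linarith

/-- (plumbing) `|(1 + p²)^s|⁻¹ ≤ 1` on a translated cell `m ≠ 0` (the damping factor of (2.5) never hurts).
[cite: FederbushWilliamson1987PhaseCellII, (2.5) p. 1417] -/
theorem inv_norm_one_add_csq_pow_le {m : Idx} (hm : m ≠ 0) {p : Momentum} (hp : p ∈ cellSet m delta0) (s : ℕ) :
    ‖(1 + csq p) ^ s‖⁻¹ ≤ 1 := by
  have hδ : delta0 ≤ 1 / 2 := delta0_le.trans (by norm_num)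
  have h6 := norm_one_add_csq_ge_of_mem_cellSet hm hδ hp
  rw [norm_pow]
  exact inv_le_one_of_one_le₀ (one_le_pow₀ (by linarith))

/-! ## §4. The compact half-tube and the compactness constants -/

/-- The closed half-tube `K = {|Re q_j| ≤ π, |Im q_j| ≤ δ₀/2}`: every `p ∈ 𝒟_B(δ₀)` is `q + 2π·cellIdx p` with `q ∈ K`.
[cite: FederbushWilliamson1987PhaseCellII, (3.2), (3.4) p. 1417] -/
def Kc : Set Momentum := {q | ∀ j, |(q j).re| ≤ π ∧ |(q j).im| ≤ delta0 / 2}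

/-- (plumbing) `K` is compact. [cite: FederbushWilliamson1987PhaseCellII, (3.4) p. 1417] -/
theorem isCompact_Kc : IsCompact Kc := by
  have hcl : IsClosed Kc := by
    have e : Kc = ⋂ j : Fin 4, {p : Momentum | |(p j).re| ≤ π} ∩ {p | |(p j).im| ≤ delta0 / 2} := by
      ext p; simp [Kc]
    rw [e]
    refine isClosed_iInter fun j => IsClosed.inter ?_ ?_
    · exact isClosed_le (continuous_abs.comp (Complex.continuous_re.comp (continuous_apply j))) continuous_const
    · exact isClosed_le (continuous_abs.comp (Complex.continuous_im.comp (continuous_apply j))) continuous_const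
  have hbd : Bornology.IsBounded Kc := by
    refine (Metric.isBounded_closedBall (x := (0 : Momentum)) (r := 5)).subset fun p hp => ?_
    rw [Metric.mem_closedBall, dist_zero_right, pi_norm_le_iff_of_nonneg (by norm_num)]
    intro j
    have h := Complex.norm_le_abs_re_add_abs_im (p j)
    have := (hp j).1; have := (hp j).2; have := delta0_le
    nlinarith [Real.pi_lt_d2]
  exact Metric.isCompact_of_isClosed_isBounded hcl hbd

/-- (plumbing) `K ⊆ tube δ₀`. [cite: FederbushWilliamson1987PhaseCellII, (3.2), (3.4) p. 1417] -/
theorem Kc_subset_tube : Kc ⊆ tube delta0 := fun q hq j =>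
  ⟨(hq j).1.trans_lt (by linarith [delta0_pos]), (hq j).2.trans_lt (by linarith [delta0_pos])⟩

/-- (plumbing) for `p ∈ 𝒟_B(δ₀)`: `p − 2π·cellIdx p ∈ K` and `p` lies in the cell of its index.
[cite: FederbushWilliamson1987PhaseCellII, (3.1), (3.4) p. 1417] -/
theorem unshift_mem_Kc {p : Momentum} (hp : p ∈ DB delta0) :
    unshift (cellIdx p) p ∈ Kc ∧ p ∈ cellSet (cellIdx p) delta0 := by
  refine ⟨fun j => ⟨abs_re_unshift_cellIdx_le p j, ?_⟩, mem_cellSet_cellIdx delta0_pos (DB_subset_DG delta0_pos.le hp)⟩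
  rw [unshift_im]; exact (hp j).le

/-- The periodic coefficient of the first term of `Gm`: `A_i(q) = ν_i(q)/(r₀(q)(1+ĝ(q)))`.
[cite: FederbushWilliamson1987PhaseCellII, (5.5)–(5.6) p. 1418] -/
def Acoef (i : Fin 4) (q : Momentum) : ℂ := num1 i q / (r0 q * (1 + ghat q))

/-- The periodic coefficient of the gauge term of `Gm`: `B(q) = q₁(q²)³/(r₀(q)⁴e₁(q)(1+ĝ(q)))`.
[cite: FederbushWilliamson1987PhaseCellII, (2.5) p. 1417, (5.3) p. 1418] -/
def Bcoef (q : Momentum) : ℂ := q 0 * csq q ^ 3 / (r0 q ^ 4 * E 0 q * (1 + ghat q))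

/-- (plumbing) `A_i` is continuous on the tube `δ₀`. [cite: FederbushWilliamson1987PhaseCellII, (5.5)–(5.6) p. 1418] -/
theorem continuousOn_Acoef (i : Fin 4) : ContinuousOn (Acoef i) (tube delta0) := by
  have hW := tube_delta0_subset_Wt
  have h : DifferentiableOn ℂ (Acoef i) (tube delta0) := by
    unfold Acoef
    exact differentiableOn_div (differentiableOn_num1 i)
      (((analyticOnNhd_r0 _).differentiableOn).mul ((differentiableOn_const _).add (differentiableOn_ghat_Wt.mono hW)))
      fun q hq => mul_ne_zero (r0_ne_zero_of_mem_tube hq) (one_add_ghat_ne_zero_of_mem_tube hq)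
  exact h.continuousOn

/-- (plumbing) `B` is continuous on the tube `δ₀`. [cite: FederbushWilliamson1987PhaseCellII, (2.5) p. 1417, (5.3) p. 1418] -/
theorem continuousOn_Bcoef : ContinuousOn Bcoef (tube delta0) := by
  have hW := tube_delta0_subset_Wt
  have hc : DifferentiableOn ℂ csq (tube delta0) := differentiable_csq.differentiableOn
  have h : DifferentiableOn ℂ Bcoef (tube delta0) := by
    unfold Bcoef
    exact differentiableOn_div (((differentiable_apply 0).differentiableOn).mul (hc.pow 3))
      (((((analyticOnNhd_r0 _).differentiableOn).pow 4).mul ((differentiableOn_E_Wt 0).mono hW)).mul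
        ((differentiableOn_const _).add (differentiableOn_ghat_Wt.mono hW)))
      fun q hq => mul_ne_zero (mul_ne_zero (pow_ne_zero _ (r0_ne_zero_of_mem_tube hq)) (E_ne_zero_of_mem_tube hq 0))
        (one_add_ghat_ne_zero_of_mem_tube hq)
  exact h.continuousOn

/-- **Compactness constants**: uniform bounds on `K` for `G0 s i`, `A_i`, `B` (all non-negative).
[cite: FederbushWilliamson1987PhaseCellII, Theorem 3.3 (3.5) p. 1417] -/
theorem exists_constants (s : ℕ) (i : Fin 4) : ∃ C₀ CA CB : ℝ, 0 ≤ C₀ ∧ 0 ≤ CA ∧ 0 ≤ CB ∧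
    (∀ q ∈ Kc, ‖G0 s i q‖ ≤ C₀) ∧ (∀ q ∈ Kc, ‖Acoef i q‖ ≤ CA) ∧ (∀ q ∈ Kc, ‖Bcoef q‖ ≤ CB) := by
  obtain ⟨C₀, h0⟩ := isCompact_Kc.exists_bound_of_continuousOn
    ((differentiableOn_G0 s i).continuousOn.mono Kc_subset_tube)
  obtain ⟨CA, hA⟩ := isCompact_Kc.exists_bound_of_continuousOn ((continuousOn_Acoef i).mono Kc_subset_tube)
  obtain ⟨CB, hB⟩ := isCompact_Kc.exists_bound_of_continuousOn (continuousOn_Bcoef.mono Kc_subset_tube)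
  refine ⟨max C₀ 0, max CA 0, max CB 0, le_max_right _ _, le_max_right _ _, le_max_right _ _,
    fun q hq => (h0 q hq).trans (le_max_left _ _), fun q hq => (hA q hq).trans (le_max_left _ _),
    fun q hq => (hB q hq).trans (le_max_left _ _)⟩

/-! ## §5. Theorem 3.3's bound for the corrected-gauge mode -/

/-- (plumbing) the majorant of (3.5) is bounded BELOW on the home cell `K`: `∏_j(|q_j|+1)⁻¹(|q²|+1)⁻¹ ≥ 1/40625`.
[cite: FederbushWilliamson1987PhaseCellII, (3.5) p. 1417] -/
theorem majorant_ge_of_mem_Kc {q : Momentum} (hq : q ∈ Kc) :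
    (1 : ℝ) / 40625 ≤ (∏ j, (‖q j‖ + 1)⁻¹) * (‖csq q‖ + 1)⁻¹ := by
  have hn : ∀ j, ‖q j‖ ≤ 4 := fun j => by
    have h := Complex.norm_le_abs_re_add_abs_im (q j)
    have := (hq j).1; have := (hq j).2; have := delta0_le
    nlinarith [Real.pi_lt_d2]
  have h1 : ∀ j, (1 : ℝ) / 5 ≤ (‖q j‖ + 1)⁻¹ := fun j => by
    rw [inv_eq_one_div, div_le_div_iff₀ (by norm_num) (by positivity)]; linarith [hn j]
  have hc : ‖csq q‖ ≤ 64 := by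
    rw [csq_eq]
    have h : ∀ j, ‖(q j) ^ 2‖ ≤ 16 := fun j => by
      rw [norm_pow]; nlinarith [hn j, norm_nonneg (q j)]
    calc ‖(q 0) ^ 2 + (q 1) ^ 2 + (q 2) ^ 2 + (q 3) ^ 2‖
        ≤ ‖(q 0) ^ 2‖ + ‖(q 1) ^ 2‖ + ‖(q 2) ^ 2‖ + ‖(q 3) ^ 2‖ := norm_add₄_le
      _ ≤ 16 + 16 + 16 + 16 := by gcongr <;> exact h _
      _ = 64 := by norm_num
  have h2 : (1 : ℝ) / 65 ≤ (‖csq q‖ + 1)⁻¹ := by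
    rw [inv_eq_one_div, div_le_div_iff₀ (by norm_num) (by positivity)]; linarith
  rw [Fin.prod_univ_four]
  calc (1 : ℝ) / 40625 = (1 / 5) * (1 / 5) * (1 / 5) * (1 / 5) * (1 / 65) := by norm_num
    _ ≤ (‖q 0‖ + 1)⁻¹ * (‖q 1‖ + 1)⁻¹ * (‖q 2‖ + 1)⁻¹ * (‖q 3‖ + 1)⁻¹ * (‖csq q‖ + 1)⁻¹ := by
        gcongr
        · exact h1 0
        · exact h1 1
        · exact h1 2
        · exact h1 3

/-- (plumbing) `Gm` split into its two coefficients. [cite: FederbushWilliamson1987PhaseCellII, (5.1)–(5.6) p. 1417–1418] -/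
theorem Gm_eq (s : ℕ) (m : Idx) (i : Fin 4) (p : Momentum) :
    Gm s m i p = Phi p * lam m 0 p * lam m i p * Acoef i (unshift m p) / csq p
      + Phi p * lam m 0 p * p i * r0 p ^ 3 * (∏ j, lam m j p ^ 2) * Bcoef (unshift m p) /
        (csq p ^ 4 * (1 + csq p) ^ s) := by
  unfold Gm Acoef Bcoef
  set g1 := 1 + ghat (unshift m p)
  ring

/-- **The bound on a translated cell `m ≠ 0`**: `‖Gm s m i p‖ ≤ (576·C_A + 2^40·C_B)·∏_j(‖p_j‖+1)⁻¹(‖p²‖+1)⁻¹` for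
`p` in the cell with `q = p − 2πm ∈ K`. [cite: FederbushWilliamson1987PhaseCellII, Theorem 3.3 (3.5) p. 1417] -/
theorem norm_Gm_le (s : ℕ) {m : Idx} (hm : m ≠ 0) (i : Fin 4) {CA CB : ℝ} (hCA : 0 ≤ CA) (hCB : 0 ≤ CB)
    (hA : ∀ q ∈ Kc, ‖Acoef i q‖ ≤ CA) (hB : ∀ q ∈ Kc, ‖Bcoef q‖ ≤ CB) {p : Momentum} (hp : p ∈ cellSet m delta0)
    (hq : unshift m p ∈ Kc) :
    ‖Gm s m i p‖ ≤ (576 * CA + 2 ^ 84 * CB) * ((∏ j, (‖p j‖ + 1)⁻¹) * (‖csq p‖ + 1)⁻¹) := by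
  have hδ : delta0 ≤ 1 / 2 := delta0_le.trans (by norm_num)
  have him1 : ∀ j, |(p j).im| ≤ 1 := fun j => by
    have h := (hp j).2; rw [unshift_im] at h; linarith [delta0_le]
  have hPhi := norm_Phi_le him1
  have hl0 := norm_lam_zero_le hp
  have hli := norm_lam_le hp i
  have h5 := norm_csq_ge_of_mem_cellSet hm hδ hp
  have hcinv := inv_norm_csq_le h5
  have hAq := hA _ hq
  have hBq := hB _ hq
  have hr := norm_r0_le him1
  have hpl := norm_prod_lam_sq_le hp
  have hpi := norm_apply_le_norm_csq hm hp i
  have hpow := inv_norm_one_add_csq_pow_le hm hp s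
  set P := (‖p 1‖ + 1)⁻¹ * (‖p 2‖ + 1)⁻¹ * (‖p 3‖ + 1)⁻¹ with hP
  have hP0 : 0 ≤ P := by positivity
  have hc0 : 0 < ‖csq p‖ := by linarith
  have hM : (∏ j, (‖p j‖ + 1)⁻¹) * (‖csq p‖ + 1)⁻¹ = (‖p 0‖ + 1)⁻¹ * P * (‖csq p‖ + 1)⁻¹ := by
    rw [Fin.prod_univ_four, hP]; ring
  rw [Gm_eq, hM]
  refine (norm_add_le _ _).trans ?_
  -- first term
  have hT1 : ‖Phi p * lam m 0 p * lam m i p * Acoef i (unshift m p) / csq p‖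
      ≤ 576 * CA * ((‖p 0‖ + 1)⁻¹ * P * (‖csq p‖ + 1)⁻¹) := by
    rw [norm_div, norm_mul, norm_mul, norm_mul, div_eq_mul_inv]
    calc ‖Phi p‖ * ‖lam m 0 p‖ * ‖lam m i p‖ * ‖Acoef i (unshift m p)‖ * ‖csq p‖⁻¹
        ≤ (40 * P) * (6 * (‖p 0‖ + 1)⁻¹) * 2 * CA * (6 / 5 * (‖csq p‖ + 1)⁻¹) := by gcongr
      _ = 576 * CA * ((‖p 0‖ + 1)⁻¹ * P * (‖csq p‖ + 1)⁻¹) := by ring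
  -- second term: `‖p_i‖/‖p²‖⁴ ≤ (6/5)·(1/25)·(6/5)(‖p²‖+1)⁻¹`
  have hpi' : ‖p i‖ * (‖csq p‖ ^ 4)⁻¹ ≤ 6 / 5 * (1 / 25) * (6 / 5 * (‖csq p‖ + 1)⁻¹) := by
    have h1 : ‖p i‖ ≤ 6 / 5 * ‖csq p‖ := by linarith
    have h2 : (‖csq p‖ ^ 4)⁻¹ = ‖csq p‖⁻¹ * (‖csq p‖⁻¹ * ‖csq p‖⁻¹) * ‖csq p‖⁻¹ := by
      rw [← mul_inv, ← mul_inv, ← mul_inv]; ring_nf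
    have h3 : ‖csq p‖⁻¹ ≤ 1 / 5 := by rw [inv_eq_one_div, div_le_div_iff₀ hc0 (by norm_num)]; linarith
    rw [h2]
    calc ‖p i‖ * (‖csq p‖⁻¹ * (‖csq p‖⁻¹ * ‖csq p‖⁻¹) * ‖csq p‖⁻¹)
        = (‖p i‖ * ‖csq p‖⁻¹) * (‖csq p‖⁻¹ * ‖csq p‖⁻¹) * ‖csq p‖⁻¹ := by ring
      _ ≤ (6 / 5) * ((1 / 5) * (1 / 5)) * (6 / 5 * (‖csq p‖ + 1)⁻¹) := by
          gcongr
          · calc ‖p i‖ * ‖csq p‖⁻¹ ≤ (6 / 5 * ‖csq p‖) * ‖csq p‖⁻¹ := by gcongr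
              _ = 6 / 5 := by field_simp
      _ = 6 / 5 * (1 / 25) * (6 / 5 * (‖csq p‖ + 1)⁻¹) := by ring
  have hT2 : ‖Phi p * lam m 0 p * p i * r0 p ^ 3 * (∏ j, lam m j p ^ 2) * Bcoef (unshift m p) /
        (csq p ^ 4 * (1 + csq p) ^ s)‖ ≤ 2 ^ 84 * CB * ((‖p 0‖ + 1)⁻¹ * P * (‖csq p‖ + 1)⁻¹) := by
    rw [norm_div, norm_mul, norm_mul, norm_mul, norm_mul, norm_mul, norm_mul, norm_pow, norm_pow, div_eq_mul_inv,
      mul_inv]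
    have hr3 : ‖r0 p‖ ^ 3 ≤ (8 ^ 8) ^ 3 := by gcongr
    calc ‖Phi p‖ * ‖lam m 0 p‖ * ‖p i‖ * ‖r0 p‖ ^ 3 * ‖∏ j, lam m j p ^ 2‖ * ‖Bcoef (unshift m p)‖ *
          ((‖csq p‖ ^ 4)⁻¹ * ‖(1 + csq p) ^ s‖⁻¹)
        = ‖Phi p‖ * ‖lam m 0 p‖ * (‖p i‖ * (‖csq p‖ ^ 4)⁻¹) * ‖r0 p‖ ^ 3 * ‖∏ j, lam m j p ^ 2‖ *
          ‖Bcoef (unshift m p)‖ * ‖(1 + csq p) ^ s‖⁻¹ := by ring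
      _ ≤ (40 * P) * (6 * (‖p 0‖ + 1)⁻¹) * (6 / 5 * (1 / 25) * (6 / 5 * (‖csq p‖ + 1)⁻¹)) * (8 ^ 8) ^ 3 * 256 *
          CB * 1 := by gcongr
      _ ≤ 2 ^ 84 * CB * ((‖p 0‖ + 1)⁻¹ * P * (‖csq p‖ + 1)⁻¹) := by
          have : 0 ≤ CB * ((‖p 0‖ + 1)⁻¹ * P * (‖csq p‖ + 1)⁻¹) := by positivity
          nlinarith
  calc _ ≤ 576 * CA * ((‖p 0‖ + 1)⁻¹ * P * (‖csq p‖ + 1)⁻¹) + 2 ^ 84 * CB * ((‖p 0‖ + 1)⁻¹ * P * (‖csq p‖ + 1)⁻¹) :=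
        add_le_add hT1 hT2
    _ = (576 * CA + 2 ^ 84 * CB) * ((‖p 0‖ + 1)⁻¹ * P * (‖csq p‖ + 1)⁻¹) := by ring

/-- **THEOREM 3.3 (Boundedness) for the corrected-gauge mode**: on `𝒟_B(δ₀) = {|Im p_j| < δ₀/2}`,
`|gcorr s i(p)| ≤ c·∏_j(|p_j|+1)⁻¹(|p²|+1)⁻¹` — the bound (3.5), constant by compactness.
[cite: FederbushWilliamson1987PhaseCellII, Theorem 3.3 (3.4)–(3.5) p. 1417] -/
theorem norm_gcorr_le (s : ℕ) (i : Fin 4) :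
    ∃ c : ℝ, 0 ≤ c ∧ ∀ p ∈ DB delta0, ‖gcorr s i p‖ ≤ c * (∏ j, (‖p j‖ + 1)⁻¹) * (‖csq p‖ + 1)⁻¹ := by
  obtain ⟨C₀, CA, CB, hC₀, hCA, hCB, h0, hA, hB⟩ := exists_constants s i
  refine ⟨40625 * C₀ + (576 * CA + 2 ^ 84 * CB), by positivity, fun p hp => ?_⟩
  obtain ⟨hqK, hcell⟩ := unshift_mem_Kc hp
  have hMpos : 0 ≤ (∏ j, (‖p j‖ + 1)⁻¹) * (‖csq p‖ + 1)⁻¹ := by positivity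
  rw [gcorr_eq, mul_assoc]
  by_cases hm : cellIdx p = 0
  · -- home cell: `gcorr = G0`, bounded on `K`, majorant bounded below
    have e : Grep s (cellIdx p) i = G0 s i := by simp [Grep, hm]
    rw [e]
    rw [hm, unshift_zero] at hqK
    have h1 := h0 p hqK
    have h2 := majorant_ge_of_mem_Kc hqK
    calc ‖G0 s i p‖ ≤ C₀ := h1
      _ = 40625 * C₀ * (1 / 40625) := by ring
      _ ≤ 40625 * C₀ * ((∏ j, (‖p j‖ + 1)⁻¹) * (‖csq p‖ + 1)⁻¹) := by gcongr
      _ ≤ (40625 * C₀ + (576 * CA + 2 ^ 84 * CB)) * ((∏ j, (‖p j‖ + 1)⁻¹) * (‖csq p‖ + 1)⁻¹) :=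
          mul_le_mul_of_nonneg_right (by nlinarith) hMpos
  · have e : Grep s (cellIdx p) i = Gm s (cellIdx p) i := by simp [Grep, hm]
    rw [e]
    calc ‖Gm s (cellIdx p) i p‖ ≤ (576 * CA + 2 ^ 84 * CB) * ((∏ j, (‖p j‖ + 1)⁻¹) * (‖csq p‖ + 1)⁻¹) :=
          norm_Gm_le s hm i hCA hCB hA hB hcell hqK
      _ ≤ (40625 * C₀ + (576 * CA + 2 ^ 84 * CB)) * ((∏ j, (‖p j‖ + 1)⁻¹) * (‖csq p‖ + 1)⁻¹) :=
          mul_le_mul_of_nonneg_right (by nlinarith) hMpos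

/-! ## §6. Theorems 3.1–3.3 for the corrected-gauge mode, in the printed shapes -/

/-- **(3.5) for `gcorr`, strict form** (as printed, with the constant `c + 1`). [cite: FederbushWilliamson1987PhaseCellII,
Theorem 3.3 (3.5) p. 1417] -/
theorem norm_gcorr_lt (s : ℕ) (i : Fin 4) :
    ∃ c : ℝ, ∀ p ∈ DB delta0, ‖gcorr s i p‖ < c * (∏ j, 1 / (‖p j‖ + 1)) * (1 / (‖csq p‖ + 1)) := by
  obtain ⟨c, hc, hb⟩ := norm_gcorr_le s i
  refine ⟨c + 1, fun p hp => ?_⟩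
  have hM : 0 < (∏ j, (‖p j‖ + 1)⁻¹) * (‖csq p‖ + 1)⁻¹ := by positivity
  have e : (∏ j, 1 / (‖p j‖ + 1)) * (1 / (‖csq p‖ + 1)) = (∏ j, (‖p j‖ + 1)⁻¹) * (‖csq p‖ + 1)⁻¹ := by
    simp [one_div]
  rw [mul_assoc, e]
  calc ‖gcorr s i p‖ ≤ c * (∏ j, (‖p j‖ + 1)⁻¹) * (‖csq p‖ + 1)⁻¹ := hb p hp
    _ = c * ((∏ j, (‖p j‖ + 1)⁻¹) * (‖csq p‖ + 1)⁻¹) := by ring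
    _ < (c + 1) * ((∏ j, (‖p j‖ + 1)⁻¹) * (‖csq p‖ + 1)⁻¹) := by nlinarith

/-- **Theorem 3.3's statement for `Â_i`** (the shape of `ModeAnalyticity.Theorem33` with `A^N ↦ Â`, `ε₀ = δ₀`): an
analytic continuation to `𝒟_G(δ₀)` agreeing with `Â_i = A′_i + p_iX_c` at the real generic momenta and obeying (3.5) on
`𝒟_B(δ₀)`. [cite: FederbushWilliamson1987PhaseCellII, Theorem 3.3 (3.4)–(3.5) p. 1417] -/
theorem theorem33_corrected (s : ℕ) (i : Fin 4) :
    ∃ g : Momentum → ℂ, AnalyticOnNhd ℂ g (DG delta0) ∧ (∀ p ∈ realGeneric, g p = ANc s i p) ∧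
      ∃ c : ℝ, ∀ p ∈ DB delta0, ‖g p‖ < c * (∏ j, 1 / (‖p j‖ + 1)) * (1 / (‖csq p‖ + 1)) :=
  ⟨gcorr s i, analyticOnNhd_gcorr s i, fun _ hp => gcorr_eq_ANc_of_realGeneric s i hp, norm_gcorr_lt s i⟩

/-- **THEOREMS 3.1–3.3 for the mode in the corrected gauge `X_c = X/(1+g)`** — EXACTLY the body of
`ModeAnalyticity.Theorems31to33` («s … sufficiently large» outermost, a common `ε₀` for 𝒟_L/𝒟_G/𝒟_B per component) with
the printed `A^N = A′ + pX` replaced by `Â = A′ + pX_c`; here every `s` works (`s₀ = 0`) and `ε₀ = δ₀` is uniform in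
`s, i`.  (For the printed `A^N` the same statement is FALSE: `ModeAnalyticityThm31Refutation.not_theorems31to33`.)
[cite: FederbushWilliamson1987PhaseCellII, Theorems 3.1–3.3 (3.2)–(3.5) p. 1417] -/
theorem theorems31to33_corrected :
    ∃ s₀ : ℕ, ∀ s, s₀ ≤ s → ∀ i : Fin 4, ∃ ε₀ > (0 : ℝ), ∃ g : Momentum → ℂ,
      AnalyticOnNhd ℂ g (DL ε₀) ∧ AnalyticOnNhd ℂ g (DG ε₀) ∧ (∀ p ∈ realGeneric, g p = ANc s i p) ∧
        ∃ c : ℝ, ∀ p ∈ DB ε₀, ‖g p‖ < c * (∏ j, 1 / (‖p j‖ + 1)) * (1 / (‖csq p‖ + 1)) :=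
  ⟨0, fun s _ i => ⟨delta0, delta0_pos, gcorr s i, analyticOnNhd_gcorr_DL s i, analyticOnNhd_gcorr s i,
    fun _ hp => gcorr_eq_ANc_of_realGeneric s i hp, norm_gcorr_lt s i⟩⟩

/-! ## §7. §IV: I (3.13)–(3.15) for the corrected-gauge mode -/

/-- **§IV for the corrected mode — I (3.13)–(3.15) hold for the position-space field of `Â = A′ + pX_c`**: there is a
momentum-space mode `g` equal to `Â_i` at every real generic momentum (all four `i`; `g_i` = its analytic continuation)
whose Fourier transform `ModeDecay.modeField g` satisfies the exponential decay / Hölder package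
`AbelianAveraging.Decay313to315` of I (3.13)–(3.15) — by r17's Paley–Wiener theorem
`ModeDecay.decay313to315_of_theorem33_shape` («follow directly from Theorems 3.2 and 3.3 … by standard techniques»).
[cite: FederbushWilliamson1987PhaseCellII, §IV p. 1417; Federbush1986PhaseCellI, (3.13)–(3.15) p. 328] -/
theorem decay313to315_corrected (s : ℕ) :
    ∃ g : Fin 4 → Momentum → ℂ, (∀ i, ∀ p ∈ realGeneric, g i p = ANc s i p) ∧
      AbelianAveraging.Decay313to315 (modeField g) := by
  have h := fun i : Fin 4 => theorem33_corrected s i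
  choose g hA hagree c hc using h
  exact ⟨g, hagree, decay313to315_of_theorem33_shape (εf := fun _ => delta0) (cf := c) (fun _ => delta0_pos) hA hc⟩

/-- The same with «s sufficiently large» outermost, as print quantifies it (every `s` works).
[cite: FederbushWilliamson1987PhaseCellII, §IV p. 1417, (2.5) p. 1417; Federbush1986PhaseCellI, (3.13)–(3.15) p. 328] -/
theorem decay313to315_corrected_all :
    ∃ s₀ : ℕ, ∀ s, s₀ ≤ s → ∃ g : Fin 4 → Momentum → ℂ,
      (∀ i, ∀ p ∈ realGeneric, g i p = ANc s i p) ∧ AbelianAveraging.Decay313to315 (modeField g) :=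
  ⟨0, fun s _ => decay313to315_corrected s⟩

end ModeAnalyticityThm33Corrected

end Literature.MathematicalPhysics.QuantumFieldTheory.Federbush1986
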